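import Summits.SmoothPoincare4.SmoothPoincare4.Theses.SullivanDual

/-!
# Route SullivanDual: `AdmissibleJExists` is a verbatim consequence of the crux `HyperbolicEnd`

Support item stmt-SmoothPoincare4-7830 (`AdmissibleJExists`: every punctured homotopy 4-sphere
carries a smooth `J`, `J² = -1`, standard on a punctured chart-ball whose closure lies in the chart
target) is, clause by clause, the crux `HyperbolicEnd` (stmt-SmoothPoincare4-7825) with its last
conjunct (Brody hyperbolicity modulo the end) dropped — the route files it "against vacuity" of the
object class of that crux. This file records the projection, so that the item also closes as soon
as the crux does (pure logic).
-/

-- the registered namespace `Summit.SmoothPoincare4.SmoothPoincare4.Theorems` repeats a component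
set_option linter.dupNamespace false

namespace Summit.SmoothPoincare4.SmoothPoincare4.Theorems.SullivanDual

/-- `HyperbolicEnd → AdmissibleJExists`: forget the hyperbolicity conjunct. [folklore] -/
theorem admissibleJExists_of_hyperbolicEnd (h : Theses.SullivanDual.HyperbolicEnd) :
    Theses.SullivanDual.AdmissibleJExists := by
  intro S p
  obtain ⟨J, ε', hε', hball, hJ2, hJs, hstd, -⟩ := h S p
  exact ⟨J, ε', hε', hball, hJ2, hJs, hstd⟩

end Summit.SmoothPoincare4.SmoothPoincare4.Theorems.SullivanDual
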